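/-
Copyright (c) 2026 the pub-hodgecm-mathlib formalisation cell (harness21).  Prover seat hodgecm-mathlib-K2Liu-p08 (g4), Track B «K2-LIT» ∕ hLiu418
#184♮, socket #42S organ S1 (ROAD W), brick F7∕F8 (T3-frame (iii-a), generic) (LEAD F0P6-plan (g14) BATCH #8 (4) «(iii) `cells_equiv` = K2Liu-p08 NOW»;
K2Liu-p01 (g8) SPEC-F7-FrameStep ab42186030930277 §2 (iii)).  2026-09-04.  KERNEL: theorems only.
-/
import Mathlib.GroupTheory.QuotientGroup.Basic
import Mathlib.SetTheory.Cardinal.Finite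
import HarnessLib

/-!
# Crux `HLiu418`, #42S-S1 ROAD W, brick (T3-frame (iii-a)): TRANSPORT OF CELL COUNTS ALONG AN INJECTIVE ADDITIVE MAP

Cell `hodgecm-mathlib`, crux item hLiu418 = `stmt-HodgeConjecture-24832` (helper lane `--supports … --as helper`, count-neutral).  THEOREMS ONLY (no `def`, no instance,
no notation, no named-fact hypothesis, no `sorry`).  GENERIC (any additive commutative groups): the frame step (iii) `cells_equiv` of K2Liu-p01 (g8)'s SPEC-F7-FrameStep moves
★ (T2)'s cell count `Nat.card (mk_P '' W)` from the Y-model (`Fin 12 → L⁺_v`, cell `ϖ^m S₀²`) to ★ (T3-core)'s integral coordinates (`(Fin 2 → 𝒪_w)³`, cell `ker red`; split: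
`(Fin 2 → 𝒪_{w₀})⁶`, ★ (T3-core-split)) along the coordinate map, which is an INJECTIVE additive map `ι : A →+ Y` (integral frame coordinates ↪ the `L⁺_v`-linear Y-model) with
`cell_Y = ι(cell_A)` and `W_Y = ι(W_A)`.  This file is that transport, once and for all place types:
* §1 `quotientMap_injective_of_injective` (`A ⧸ P → Y ⧸ ι(P)` is injective for injective `ι`), `image_mk_image_eq_image_map`, HEAD **`natCard_image_mk_image_eq`**:
  `Nat.card (mk_{ι(P)} '' ι(W)) = Nat.card (mk_P '' W)`; `finite_image_mk_image_iff`; **`natCard_image_mk_range_eq`**: `Nat.card (mk_{ι(P)} '' range ι) = Nat.card (A ⧸ P)` (the box∕cell index,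
  ★ (T3-core) `natCard_quotient_cell = q^{12m}`); `saturated_image` (★ (T2)'s saturation hypothesis transports);
* §2 the `AddEquiv` form **`natCard_image_mk_preimage_eq`** (`κ : X ≃+ Y`, sets and cells given on `Y`, read on `X` by preimage).
[Shimura1997, §13.2] [Weil1965, §2 (lattice indices under isogeny)].
HONEST LABEL.  Count-neutral helper; `HC_CM` is proved only modulo the 7 printed citations (2 remaining named inputs: hLiu418 = `stmt-HodgeConjecture-24832`,
h413 = `stmt-HodgeConjecture-24833`) until rung 0 closes.

## References
* [Shimura1997] G. Shimura, *Euler products and Eisenstein series*, CBMS 93 (1997), §13.2.   * [Weil1965] A. Weil, Acta Math. 113 (1965), §2.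
-/

set_option autoImplicit false
set_option linter.dupNamespace false -- the mandated namespace repeats `HodgeConjecture.HodgeConjecture`

namespace Summit.HodgeConjecture.HodgeConjecture.Cruxes.HLiu418.K2LiuCellCountTransport

/-! ## §1 Injective additive maps -/

section Injective

variable {A Y : Type*} [AddCommGroup A] [AddCommGroup Y] (ι : A →+ Y) (P : AddSubgroup A)

/-- **`A ⧸ P → Y ⧸ ι(P)` is injective** when `ι` is (`ι a ∈ ι(P) ⇒ a ∈ P`). [folklore] -/
theorem quotientMap_injective_of_injective (hι : Function.Injective ι) :
    Function.Injective (QuotientAddGroup.map P (P.map ι) ι (P.le_comap_map ι)) := by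
  refine (QuotientAddGroup.map P (P.map ι) ι (P.le_comap_map ι)).ker_eq_bot_iff.1 ((AddSubgroup.eq_bot_iff_forall _).2 ?_)
  intro q hq
  obtain ⟨a, rfl⟩ := QuotientAddGroup.mk_surjective q
  rw [AddMonoidHom.mem_ker, QuotientAddGroup.map_mk, QuotientAddGroup.eq_zero_iff] at hq
  obtain ⟨p, hp, hpa⟩ := AddSubgroup.mem_map.1 hq
  rw [QuotientAddGroup.eq_zero_iff, ← hι hpa]
  exact hp

/-- the classes of `ι(W)` modulo `ι(P)` are the images of the classes of `W` modulo `P`. [folklore] -/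
theorem image_mk_image_eq_image_map (W : Set A) :
    (QuotientAddGroup.mk : Y → Y ⧸ P.map ι) '' (ι '' W) = QuotientAddGroup.map P (P.map ι) ι (P.le_comap_map ι) '' ((QuotientAddGroup.mk : A → A ⧸ P) '' W) := by
  rw [Set.image_image, Set.image_image]
  exact Set.image_congr fun a _ => (QuotientAddGroup.map_mk P (P.map ι) ι (P.le_comap_map ι) a).symm

/-- **TRANSPORT OF THE CELL COUNT** (HEAD): `Nat.card (mk_{ι(P)} '' ι(W)) = Nat.card (mk_P '' W)` for an injective additive `ι`. [cite: Shimura1997, §13.2] -/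
theorem natCard_image_mk_image_eq (hι : Function.Injective ι) (W : Set A) :
    Nat.card ((QuotientAddGroup.mk : Y → Y ⧸ P.map ι) '' (ι '' W)) = Nat.card ((QuotientAddGroup.mk : A → A ⧸ P) '' W) := by
  rw [image_mk_image_eq_image_map ι P W]
  exact Nat.card_image_of_injective (quotientMap_injective_of_injective ι P hι) _

/-- finiteness of the classes transports both ways. [folklore] -/
theorem finite_image_mk_image_iff (hι : Function.Injective ι) (W : Set A) :
    ((QuotientAddGroup.mk : Y → Y ⧸ P.map ι) '' (ι '' W)).Finite ↔ ((QuotientAddGroup.mk : A → A ⧸ P) '' W).Finite := by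
  rw [image_mk_image_eq_image_map ι P W]
  exact Set.finite_image_iff (quotientMap_injective_of_injective ι P hι).injOn

/-- **THE BOX∕CELL INDEX TRANSPORTS**: `Nat.card (mk_{ι(P)} '' range ι) = Nat.card (A ⧸ P)` (e.g. `= q^{12m}`, ★ (T3-core) `natCard_quotient_cell`). [cite: Weil1965, §2] -/
theorem natCard_image_mk_range_eq (hι : Function.Injective ι) :
    Nat.card ((QuotientAddGroup.mk : Y → Y ⧸ P.map ι) '' Set.range ι) = Nat.card (A ⧸ P) := by
  rw [← Set.image_univ, natCard_image_mk_image_eq ι P hι, Set.image_univ, Set.range_eq_univ.2 (QuotientAddGroup.mk_surjective (s := P))]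
  exact Nat.card_congr (Equiv.Set.univ _)

/-- **SATURATION TRANSPORTS** (★ (T2)'s hypothesis): if `W` is `P`-saturated then `ι(W)` is `ι(P)`-saturated. [folklore] -/
theorem saturated_image {W : Set A} (hW : ∀ a ∈ W, ∀ p ∈ P, a + p ∈ W) :
    ∀ y ∈ ι '' W, ∀ p ∈ P.map ι, y + p ∈ ι '' W := by
  rintro _ ⟨a, ha, rfl⟩ _ hp
  obtain ⟨p, hp', rfl⟩ := AddSubgroup.mem_map.1 hp
  exact ⟨a + p, hW a ha p hp', map_add ι a p⟩

/-- the image cell is the image: `y ∈ ι(P) ↔ ∃ p ∈ P, ι p = y` (Mathlib `AddSubgroup.mem_map`, recorded for the call sites). [folklore] -/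
theorem mem_map_iff (y : Y) : y ∈ P.map ι ↔ ∃ p ∈ P, ι p = y := AddSubgroup.mem_map

end Injective

/-! ## §2 Additive equivalences, sets given on the target -/

section Equiv

variable {X Y : Type*} [AddCommGroup X] [AddCommGroup Y] (κ : X ≃+ Y) (Q : AddSubgroup Y)

/-- `κ(κ⁻¹ Q) = Q` for an additive equivalence. [folklore] -/
theorem map_comap_eq : (Q.comap κ.toAddMonoidHom).map κ.toAddMonoidHom = Q :=
  AddSubgroup.map_comap_eq_self_of_surjective κ.surjective Q

/-- **TRANSPORT ALONG AN ADDITIVE EQUIVALENCE, sets and cells given on the target** (the Y-model side: `S₀²`-box, `ϖ^m S₀²`-cell, `D_m ∩ (S₁² ∖ S₂²)` as preimages under the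
coordinate iso `κ`): `Nat.card (mk_{κ⁻¹Q} '' κ⁻¹(W)) = Nat.card (mk_Q '' W)`. [cite: Shimura1997, §13.2] -/
theorem natCard_image_mk_preimage_eq (W : Set Y) :
    Nat.card ((QuotientAddGroup.mk : X → X ⧸ Q.comap κ.toAddMonoidHom) '' (κ ⁻¹' W)) = Nat.card ((QuotientAddGroup.mk : Y → Y ⧸ Q) '' W) := by
  have h := natCard_image_mk_image_eq κ.toAddMonoidHom (Q.comap κ.toAddMonoidHom) κ.injective (κ ⁻¹' W)
  have hW : (κ.toAddMonoidHom : X → Y) '' (κ ⁻¹' W) = W := Set.image_preimage_eq W κ.surjective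
  rw [hW] at h
  -- the two quotients of `Y` are by the same subgroup `κ(κ⁻¹Q) = Q`
  have hQ : (Q.comap κ.toAddMonoidHom).map κ.toAddMonoidHom = Q := map_comap_eq κ Q
  rw [hQ] at h
  exact h.symm

/-- saturation read through the equivalence: `κ⁻¹(W)` is `κ⁻¹(Q)`-saturated iff `W` is `Q`-saturated. [folklore] -/
theorem saturated_preimage_of_saturated {W : Set Y} (hW : ∀ y ∈ W, ∀ q ∈ Q, y + q ∈ W) :
    ∀ x ∈ κ ⁻¹' W, ∀ p ∈ Q.comap κ.toAddMonoidHom, x + p ∈ κ ⁻¹' W := by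
  intro x hx p hp
  rw [Set.mem_preimage, map_add]
  exact hW _ hx _ hp

end Equiv

end Summit.HodgeConjecture.HodgeConjecture.Cruxes.HLiu418.K2LiuCellCountTransport
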